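import Literature.NumberTheory.Transcendental.PhilipponZeroEstimateLoc
import Mathlib.RingTheory.MvPolynomial.Basic
import HarnessLib

/-!
# Zero estimates on commutative algebraic groups, VIII: cumulative Hilbert functions of `ℂ[X₀,…,X_N]`

Topic `Literature/NumberTheory/Transcendental`. Eighth module of the discharge of
`Literature.NumberTheory.Transcendental.philippon1986_std` through D. Roy's exposition of
Philippon's zero estimate (Nesterenko–Philippon (eds.), LNM 1752, Ch. 11, §2.2). The degree theory
of the projective zero estimate, in the lossy form sufficient for Philippon's theorem (any
constant depending only on the group), is run — exactly as in the tree's multiplicity version for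
`𝔾ₐ × 𝔾ₘⁿ` (`GaGmBezout.lean`, `PhilipponZeroEstimateHilbert.lean`, `PhilipponZeroEstimateLoc.lean`,
whose box filtration is replaced by the filtration by total degree) — with the
**cumulative Hilbert function** `H_N(t) = dim_ℂ ℂ[X]_{≤t} - dim_ℂ (ℂ[X]_{≤t} ∩ N)` of an arbitrary
`ℂ`-subspace `N ⊆ ℂ[X₀,…,X_N]` (`ZeroEst.hilbC`; for a homogeneous ideal it is the sum of the values
of the usual Hilbert function, for a prime `𝔭` it is the Hilbert function of the affine cone
`ℂ[X]/𝔭` with respect to the generating subspace `ℂ[X]_{≤1}`, so that the filtered-algebra sandwich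
`Literature.RingTheory.HilbertSamuel.FilteredHilbert.hilbert_sandwich` applies). PROVED here:

* `ZeroEst.Fil t = ℂ[X]_{≤t}` (Mathlib's `restrictTotalDegree`), `Fil s · Fil d ⊆ Fil (s+d)`,
  `(Fil 1)^t = Fil t`; `hilbC` antitone in `N`, monotone in `t`;
* the **section inequality** `H_{J+(Q)}(t) + H_J(t-δ) ≤ H_J(t)` for `Q ∈ ℂ[X]_{≤δ}` a
  non-zero-divisor modulo `J` (§2.2 (iii)), the **additivity inequality**
  `H_N(t) + H_J(t-δ) ≤ H_{N∩J}(t)`, **thick additivity** over pairwise incomparable primes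
  (`exists_sum_hilbC_loc_le`, §2.2 (ii)), the **telescoped section inequality**
  `∑_{s≤t} H_{J+(Q)}(s) ≤ δ·H_J(t)` and the **lossy chain bound**: along a chain of `j` cuts by
  non-zero-divisors of degree `≤ δ` starting from `J₀` with `H_{J₀}(t) ≤ C (t+1)^e`,
  `H_{J_j}(t) ≤ 2^{e j} δ^j C (t+1)^{e-j}` (`hilbC_chain_le`);
* the **sandwich for a prime** `𝔭` with `dim ℂ[X]/𝔭 = d`: `ρ·binom(t-a+d, d) ≤ H_𝔭(t) ≤
  ρ·binom(t+γ+d, d)` with an integer `ρ ≥ 1` (`exists_sandwich_of_isPrime`).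

## References

* Yu. V. Nesterenko, P. Philippon (eds.), *Introduction to Algebraic Independence Theory*,
  LNM 1752, Springer 2001, Ch. 11 (D. Roy), §2.2 (i)–(iii), Prop. 2.2. [NesterenkoPhilippon2001]
* R. Hartshorne, *Algebraic Geometry*, GTM 52, Ch. I Thm. 7.5, Prop. 7.6. [Hartshorne1977]
-/

noncomputable section

open MvPolynomial Module

namespace Literature.NumberTheory.Transcendental

namespace ZeroEst

variable {N : ℕ}

/-! ### The filtration by total degree -/

/-- `ℂ[X₀,…,X_N]_{≤t}`. [folklore] -/
abbrev Fil (t : ℕ) : Submodule ℂ (MvPolynomial (Fin (N + 1)) ℂ) := restrictTotalDegree (Fin (N + 1)) ℂ t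

/-- Membership in `Fil t`. [folklore] -/
theorem mem_Fil {P : MvPolynomial (Fin (N + 1)) ℂ} {t : ℕ} : P ∈ Fil (N := N) t ↔ P.totalDegree ≤ t :=
  mem_restrictTotalDegree _ _ _

/-- `Fil` is monotone. [folklore] -/
theorem Fil_mono {t t' : ℕ} (h : t ≤ t') : Fil (N := N) t ≤ Fil t' := fun _ hP => mem_Fil.mpr ((mem_Fil.mp hP).trans h)

/-- `1 ∈ Fil t`. [folklore] -/
theorem one_mem_Fil (t : ℕ) : (1 : MvPolynomial (Fin (N + 1)) ℂ) ∈ Fil (N := N) t :=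
  mem_Fil.mpr (by simp)

/-- `Fil s · Fil d ⊆ Fil (s + d)`. [folklore] -/
theorem mul_mem_Fil {P Q : MvPolynomial (Fin (N + 1)) ℂ} {s d : ℕ} (hP : P ∈ Fil (N := N) s) (hQ : Q ∈ Fil (N := N) d) :
    P * Q ∈ Fil (N := N) (s + d) :=
  mem_Fil.mpr ((totalDegree_mul P Q).trans (Nat.add_le_add (mem_Fil.mp hP) (mem_Fil.mp hQ)))

/-- Every polynomial lies in `Fil` of its total degree. [folklore] -/
theorem mem_Fil_totalDegree (P : MvPolynomial (Fin (N + 1)) ℂ) : P ∈ Fil (N := N) P.totalDegree := mem_Fil.mpr le_rfl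

/-- `(Fil 1)^t = Fil t`: the filtration is generated in degree one. [folklore] -/
theorem Fil_one_pow (t : ℕ) : (Fil (N := N) 1) ^ t = Fil t := by
  classical
  refine le_antisymm ?_ ?_
  · induction t with
    | zero =>
      rw [pow_zero, Submodule.one_le]
      exact one_mem_Fil 0
    | succ t ih =>
      rw [pow_succ]
      refine Submodule.mul_le.mpr fun P hP Q hQ => ?_
      exact mul_mem_Fil (ih hP) hQ
  · -- `Fil t` is spanned by the monomials of degree `≤ t`, each a product of `t` elements of `Fil 1`
    intro P hP
    rw [mem_Fil] at hP
    rw [P.as_sum]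
    refine Submodule.sum_mem _ fun m hm => ?_
    have hdeg : m.sum (fun _ e => e) ≤ t := (le_totalDegree hm).trans hP
    rw [show monomial m (P.coeff m) = P.coeff m • monomial m (1 : ℂ) by rw [smul_monomial, smul_eq_mul, mul_one]]
    refine Submodule.smul_mem _ _ ?_
    -- `X^m = ∏ X_i^{m_i} · 1^{t - |m|}`
    have hmon : (monomial m (1 : ℂ) : MvPolynomial (Fin (N + 1)) ℂ) = ∏ i ∈ m.support, X i ^ m i := by
      rw [monomial_eq, C_1, one_mul, Finsupp.prod]
    rw [hmon]
    have hX : ∀ i, (X i : MvPolynomial (Fin (N + 1)) ℂ) ∈ Fil (N := N) 1 := fun i => mem_Fil.mpr (by simp)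
    have hprod : ∀ (s : Finset (Fin (N + 1))), (∏ i ∈ s, X i ^ m i : MvPolynomial (Fin (N + 1)) ℂ) ∈
        (Fil (N := N) 1) ^ (∑ i ∈ s, m i) := by
      intro s
      induction s using Finset.induction_on with
      | empty => simp [Submodule.mem_one]; exact ⟨1, by simp⟩
      | insert i s hi ih =>
        rw [Finset.prod_insert hi, Finset.sum_insert hi, pow_add]
        exact Submodule.mul_mem_mul (Submodule.pow_mem_pow _ (hX i) _) ih
    have hsum : ∑ i ∈ m.support, m i = m.sum fun _ e => e := rfl
    have hle : ∑ i ∈ m.support, m i ≤ t := hsum ▸ hdeg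
    have key := hprod m.support
    -- pad with ones
    have hpad : (Fil (N := N) 1) ^ (∑ i ∈ m.support, m i) ≤ (Fil (N := N) 1) ^ t := by
      intro x hx
      rw [← Nat.add_sub_cancel' hle, pow_add, ← mul_one x]
      refine Submodule.mul_mem_mul hx ?_
      simpa using Submodule.pow_mem_pow (Fil (N := N) 1) (one_mem_Fil 1) (t - ∑ i ∈ m.support, m i)
    exact hpad key

/-- `Fil 1` generates `ℂ[X]` as an algebra. [folklore] -/
theorem adjoin_Fil_one : Algebra.adjoin ℂ ((Fil (N := N) 1 : Submodule ℂ (MvPolynomial (Fin (N + 1)) ℂ)) :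
    Set (MvPolynomial (Fin (N + 1)) ℂ)) = ⊤ := by
  refine top_le_iff.mp ?_
  rw [← MvPolynomial.adjoin_range_X]
  exact Algebra.adjoin_mono fun _ ⟨i, hi⟩ => hi ▸ mem_Fil.mpr (by simp)

/-! ### The cumulative Hilbert function -/

/-- **The cumulative Hilbert function** `H_N(t) = dim ℂ[X]_{≤t} - dim (ℂ[X]_{≤t} ∩ N)` of a
subspace `N ⊆ ℂ[X₀,…,X_N]`. [cite: NesterenkoPhilippon2001, Ch. 11 §2.2 (84)] -/
def hilbC (N' : Submodule ℂ (MvPolynomial (Fin (N + 1)) ℂ)) (t : ℕ) : ℕ :=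
  finrank ℂ ↥(Fil (N := N) t) - finrank ℂ ↥(Fil (N := N) t ⊓ N')

/-- `dim(Fil t ∩ N) ≤ dim Fil t`. [folklore] -/
theorem finrank_inf_le (N' : Submodule ℂ (MvPolynomial (Fin (N + 1)) ℂ)) (t : ℕ) :
    finrank ℂ ↥(Fil (N := N) t ⊓ N') ≤ finrank ℂ ↥(Fil (N := N) t) :=
  Submodule.finrank_mono inf_le_left

/-- `H_N(t) + dim(Fil t ∩ N) = dim Fil t`. [folklore] -/
theorem hilbC_add_finrank_inf (N' : Submodule ℂ (MvPolynomial (Fin (N + 1)) ℂ)) (t : ℕ) :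
    hilbC N' t + finrank ℂ ↥(Fil (N := N) t ⊓ N') = finrank ℂ ↥(Fil (N := N) t) := by
  rw [hilbC, Nat.sub_add_cancel (finrank_inf_le N' t)]

/-- `H` is antitone in the subspace. [folklore] -/
theorem hilbC_antitone {N' N'' : Submodule ℂ (MvPolynomial (Fin (N + 1)) ℂ)} (h : N' ≤ N'') (t : ℕ) :
    hilbC N'' t ≤ hilbC N' t := by
  have h1 := hilbC_add_finrank_inf N' t
  have h2 := hilbC_add_finrank_inf N'' t
  have h3 : finrank ℂ ↥(Fil (N := N) t ⊓ N') ≤ finrank ℂ ↥(Fil (N := N) t ⊓ N'') :=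
    Submodule.finrank_mono (inf_le_inf_left _ h)
  omega

/-- `H` is monotone in `t`. [folklore] -/
theorem hilbC_mono (N' : Submodule ℂ (MvPolynomial (Fin (N + 1)) ℂ)) {t t' : ℕ} (h : t ≤ t') :
    hilbC N' t ≤ hilbC N' t' := by
  have hB : Fil (N := N) t ≤ Fil t' := Fil_mono h
  have hinf : Fil (N := N) t ⊓ (Fil t' ⊓ N') = Fil t ⊓ N' := by
    rw [← inf_assoc, inf_eq_left.mpr hB]
  have hsup : Fil (N := N) t ⊔ (Fil t' ⊓ N') ≤ Fil t' := sup_le hB inf_le_left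
  have h1 := Submodule.finrank_sup_add_finrank_inf_eq (Fil (N := N) t) (Fil t' ⊓ N')
  rw [hinf] at h1
  have h2 : finrank ℂ ↥(Fil (N := N) t ⊔ (Fil t' ⊓ N')) ≤ finrank ℂ ↥(Fil (N := N) t') :=
    Submodule.finrank_mono hsup
  have h3 := hilbC_add_finrank_inf N' t
  have h4 := hilbC_add_finrank_inf N' t'
  omega

/-- `H_N(t) ≤ dim Fil t`. [folklore] -/
theorem hilbC_le (N' : Submodule ℂ (MvPolynomial (Fin (N + 1)) ℂ)) (t : ℕ) :
    hilbC N' t ≤ finrank ℂ ↥(Fil (N := N) t) := Nat.sub_le _ _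

/-! ### Sections by non-zero-divisors -/

/-- Multiplication by `a ∈ Fil δ` maps `Fil s` into `Fil (s + δ)`. [folklore] -/
theorem map_mulLeft_Fil_le {δ s : ℕ} {a : MvPolynomial (Fin (N + 1)) ℂ} (ha : a ∈ Fil (N := N) δ) :
    (Fil (N := N) s).map (LinearMap.mulLeft ℂ a) ≤ Fil (s + δ) := by
  rintro _ ⟨v, hv, rfl⟩
  have h := mul_mem_Fil ha hv
  have e : Fil (N := N) (δ + s) = Fil (s + δ) := by rw [Nat.add_comm δ s]
  rw [e] at h
  exact h

/-- The dimension identity for a non-zero-divisor `a ∈ Fil δ` modulo `J ≠ (1)`, `t ≥ δ`. [folklore] -/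
theorem finrank_mulShift_of_nzd {J : Ideal (MvPolynomial (Fin (N + 1)) ℂ)} (hJ : J ≠ ⊤)
    {a : MvPolynomial (Fin (N + 1)) ℂ} {δ : ℕ} (haB : a ∈ Fil (N := N) δ) (ha : GaGm.IsNZDMod J a)
    {t : ℕ} (ht : δ ≤ t) :
    finrank ℂ ↥((Fil (N := N) (t - δ)).map (LinearMap.mulLeft ℂ a) ⊔ (Fil t ⊓ J.restrictScalars ℂ)) +
      finrank ℂ ↥(Fil (N := N) (t - δ) ⊓ J.restrictScalars ℂ) =
    finrank ℂ ↥(Fil (N := N) (t - δ)) + finrank ℂ ↥(Fil (N := N) t ⊓ J.restrictScalars ℂ) := by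
  have ha0 : a ≠ 0 := ha.ne_zero hJ
  have h1 := Submodule.finrank_sup_add_finrank_inf_eq
    ((Fil (N := N) (t - δ)).map (LinearMap.mulLeft ℂ a)) (Fil t ⊓ J.restrictScalars ℂ)
  have hle : (Fil (N := N) (t - δ)).map (LinearMap.mulLeft ℂ a) ≤ Fil t := by
    have := map_mulLeft_Fil_le (N := N) (s := t - δ) haB
    rwa [Nat.sub_add_cancel ht] at this
  have hinf : (Fil (N := N) (t - δ)).map (LinearMap.mulLeft ℂ a) ⊓ (Fil t ⊓ J.restrictScalars ℂ) =
      (Fil (N := N) (t - δ) ⊓ J.restrictScalars ℂ).map (LinearMap.mulLeft ℂ a) := by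
    rw [← inf_assoc, inf_eq_left.mpr hle, GaGm.map_mulLeft_inf_of_nzd ha]
  rw [hinf, GaGm.finrank_map_mulLeft ha0, GaGm.finrank_map_mulLeft ha0] at h1
  omega

/-- **The section inequality** (§2.2 (iii), cumulative form): `Q ∈ Fil δ` a non-zero-divisor
modulo `J ≠ (1)`, `t ≥ δ` ⇒ `H_{J+(Q)}(t) + H_J(t-δ) ≤ H_J(t)`. [cite: NesterenkoPhilippon2001, Ch. 11 §2.2 (iii)] -/
theorem hilbC_sup_span_add_le_of_nzd {J : Ideal (MvPolynomial (Fin (N + 1)) ℂ)} (hJ : J ≠ ⊤)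
    {Q : MvPolynomial (Fin (N + 1)) ℂ} {δ : ℕ} (hQB : Q ∈ Fil (N := N) δ) (hQ : GaGm.IsNZDMod J Q)
    {t : ℕ} (ht : δ ≤ t) :
    hilbC ((J ⊔ Ideal.span {Q}).restrictScalars ℂ) t + hilbC (J.restrictScalars ℂ) (t - δ) ≤
      hilbC (N := N) (J.restrictScalars ℂ) t := by
  have key := finrank_mulShift_of_nzd hJ hQB hQ ht
  have hle : (Fil (N := N) (t - δ)).map (LinearMap.mulLeft ℂ Q) ⊔ (Fil t ⊓ J.restrictScalars ℂ) ≤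
      Fil t ⊓ (J ⊔ Ideal.span {Q}).restrictScalars ℂ := by
    refine sup_le ?_ (inf_le_inf_left _ fun x hx => Ideal.mem_sup_left hx)
    have h1 : (Fil (N := N) (t - δ)).map (LinearMap.mulLeft ℂ Q) ≤ Fil t := by
      have := map_mulLeft_Fil_le (N := N) (s := t - δ) hQB
      rwa [Nat.sub_add_cancel ht] at this
    refine le_inf h1 ?_
    rintro _ ⟨v, -, rfl⟩
    exact Ideal.mem_sup_right (Ideal.mem_span_singleton.mpr (dvd_mul_right Q v))
  have h2 := Submodule.finrank_mono hle
  have h3 := hilbC_add_finrank_inf (N := N) ((J ⊔ Ideal.span {Q}).restrictScalars ℂ) t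
  have h4 := hilbC_add_finrank_inf (N := N) (J.restrictScalars ℂ) t
  have h5 := hilbC_add_finrank_inf (N := N) (J.restrictScalars ℂ) (t - δ)
  omega

/-- **The additivity inequality**: for a subspace `N` closed under multiplication, an ideal
`J ≠ (1)` and `a ∈ N ∩ Fil δ` a non-zero-divisor modulo `J`, `t ≥ δ`:
`H_N(t) + H_J(t-δ) ≤ H_{N∩J}(t)`. [cite: NesterenkoPhilippon2001, Ch. 11 §2.2 (ii)] -/
theorem hilbC_add_le_hilbC_inf_of_nzd {N' : Submodule ℂ (MvPolynomial (Fin (N + 1)) ℂ)}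
    {J : Ideal (MvPolynomial (Fin (N + 1)) ℂ)} (hJ : J ≠ ⊤)
    {a : MvPolynomial (Fin (N + 1)) ℂ} {δ : ℕ} (haB : a ∈ Fil (N := N) δ) (haN : a ∈ N')
    (hN : ∀ (x y : MvPolynomial (Fin (N + 1)) ℂ), y ∈ N' → x * y ∈ N') (ha : GaGm.IsNZDMod J a) {t : ℕ} (ht : δ ≤ t) :
    hilbC N' t + hilbC (J.restrictScalars ℂ) (t - δ) ≤ hilbC (N' ⊓ J.restrictScalars ℂ) t := by
  have key := finrank_mulShift_of_nzd hJ haB ha ht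
  have h1 := Submodule.finrank_sup_add_finrank_inf_eq (Fil (N := N) t ⊓ N') (Fil t ⊓ J.restrictScalars ℂ)
  have hinf : Fil (N := N) t ⊓ N' ⊓ (Fil t ⊓ J.restrictScalars ℂ) = Fil t ⊓ (N' ⊓ J.restrictScalars ℂ) := by
    rw [inf_inf_inf_comm, inf_idem]
  rw [hinf] at h1
  have hle : (Fil (N := N) (t - δ)).map (LinearMap.mulLeft ℂ a) ⊔ (Fil t ⊓ J.restrictScalars ℂ) ≤
      (Fil t ⊓ N') ⊔ (Fil t ⊓ J.restrictScalars ℂ) := by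
    refine sup_le_sup_right ?_ _
    have h1 : (Fil (N := N) (t - δ)).map (LinearMap.mulLeft ℂ a) ≤ Fil t := by
      have := map_mulLeft_Fil_le (N := N) (s := t - δ) haB
      rwa [Nat.sub_add_cancel ht] at this
    refine le_inf h1 ?_
    rintro _ ⟨v, -, rfl⟩
    rw [LinearMap.mulLeft_apply, mul_comm]
    exact hN v a haN
  have h2 := Submodule.finrank_mono hle
  have h3 := hilbC_add_finrank_inf (N := N) N' t
  have h4 := hilbC_add_finrank_inf (N := N) (J.restrictScalars ℂ) (t - δ)
  have h5 := hilbC_add_finrank_inf (N := N) (N' ⊓ J.restrictScalars ℂ) t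
  have h6 := finrank_inf_le (N := N) (J.restrictScalars ℂ) t
  omega

/-- **Telescoping the section inequality for a cut of degree `δ`**:
`∑_{s ≤ t} H_{J+(Q)}(s) ≤ δ · H_J(t)`. [folklore] -/
theorem sum_hilbC_le_mul {J : Ideal (MvPolynomial (Fin (N + 1)) ℂ)} (hJ : J ≠ ⊤)
    {Q : MvPolynomial (Fin (N + 1)) ℂ} {δ : ℕ} (hQB : Q ∈ Fil (N := N) δ) (hQ : GaGm.IsNZDMod J Q) (t : ℕ) :
    ∑ s ∈ Finset.range (t + 1), hilbC ((J ⊔ Ideal.span {Q}).restrictScalars ℂ) s ≤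
      δ * hilbC (N := N) (J.restrictScalars ℂ) t := by
  set H' := fun s => hilbC (N := N) ((J ⊔ Ideal.span {Q}).restrictScalars ℂ) s with hH'
  set H := fun s => hilbC (N := N) (J.restrictScalars ℂ) s with hH
  have hle : ∀ s, H' s ≤ H s := fun s => hilbC_antitone (fun x hx => Ideal.mem_sup_left hx) s
  have hsec : ∀ s, δ ≤ s → H' s + H (s - δ) ≤ H s := fun s hs => hilbC_sup_span_add_le_of_nzd hJ hQB hQ hs
  -- `∑_{s ≤ t} H'(s) + ∑_{s ≤ t - δ} H(s) ≤ ∑_{s ≤ t} H(s)` (with the second sum empty if `t < δ`)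
  have key : ∀ t, ∑ s ∈ Finset.range (t + 1), H' s + ∑ s ∈ Finset.range (t + 1 - δ), H s ≤
      ∑ s ∈ Finset.range (t + 1), H s := by
    intro t
    induction t with
    | zero =>
      by_cases hδ : δ = 0
      · subst hδ
        have := hsec 0 le_rfl
        simp only [Nat.sub_zero] at this
        simpa using this
      · rw [show 0 + 1 - δ = 0 by omega]
        simpa using hle 0
    | succ t ih =>
      have e1 : ∑ s ∈ Finset.range (t + 1 + 1), H' s = ∑ s ∈ Finset.range (t + 1), H' s + H' (t + 1) :=
        Finset.sum_range_succ H' (t + 1)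
      have e2 : ∑ s ∈ Finset.range (t + 1 + 1), H s = ∑ s ∈ Finset.range (t + 1), H s + H (t + 1) :=
        Finset.sum_range_succ H (t + 1)
      rw [e1, e2]
      by_cases hδ : δ ≤ t + 1
      · have e3 : ∑ s ∈ Finset.range (t + 1 + 1 - δ), H s = ∑ s ∈ Finset.range (t + 1 - δ), H s + H (t + 1 - δ) := by
          rw [show t + 1 + 1 - δ = (t + 1 - δ) + 1 by omega]
          exact Finset.sum_range_succ H (t + 1 - δ)
        rw [e3]
        have := hsec (t + 1) hδ
        omega
      · have e3 : ∑ s ∈ Finset.range (t + 1 + 1 - δ), H s = 0 := by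
          rw [show t + 1 + 1 - δ = 0 by omega, Finset.sum_range_zero]
        have e4 : ∑ s ∈ Finset.range (t + 1 - δ), H s = 0 := by
          rw [show t + 1 - δ = 0 by omega, Finset.sum_range_zero]
        rw [e3]
        rw [e4] at ih
        have := hle (t + 1)
        omega
  have hsplit : ∑ s ∈ Finset.range (t + 1), H s =
      ∑ s ∈ Finset.range (t + 1 - δ), H s + ∑ s ∈ Finset.Ico (t + 1 - δ) (t + 1), H s :=
    (Finset.sum_range_add_sum_Ico _ (by omega)).symm
  have htail : ∑ s ∈ Finset.Ico (t + 1 - δ) (t + 1), H s ≤ δ * H t := by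
    calc ∑ s ∈ Finset.Ico (t + 1 - δ) (t + 1), H s ≤ ∑ s ∈ Finset.Ico (t + 1 - δ) (t + 1), H t :=
          Finset.sum_le_sum fun s hs => hilbC_mono _ (by rw [Finset.mem_Ico] at hs; omega)
      _ = (Finset.Ico (t + 1 - δ) (t + 1)).card * H t := by rw [Finset.sum_const, smul_eq_mul]
      _ ≤ δ * H t := Nat.mul_le_mul_right _ (by rw [Nat.card_Ico]; omega)
  have h := key t
  rw [hsplit] at h
  change ∑ s ∈ Finset.range (t + 1), H' s ≤ δ * H t
  omega

/-- **One lossy cut**: `Q ∈ Fil δ` a non-zero-divisor modulo `J ≠ (1)`, `J + (Q) ≤ J'` ⇒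
`(t+1) · H_{J'}(t) ≤ δ · H_J(2t+1)`. [folklore] -/
theorem succ_mul_hilbC_le {J J' : Ideal (MvPolynomial (Fin (N + 1)) ℂ)} (hJ : J ≠ ⊤)
    {Q : MvPolynomial (Fin (N + 1)) ℂ} {δ : ℕ} (hQB : Q ∈ Fil (N := N) δ) (hQ : GaGm.IsNZDMod J Q)
    (hJ' : J ⊔ Ideal.span {Q} ≤ J') (t : ℕ) :
    (t + 1) * hilbC (J'.restrictScalars ℂ) t ≤ δ * hilbC (N := N) (J.restrictScalars ℂ) (2 * t + 1) := by
  have hmono : Monotone fun s => hilbC (N := N) (J'.restrictScalars ℂ) s := fun s s' h => hilbC_mono _ h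
  refine (GaGm.mul_le_sum_of_monotone hmono t).trans ?_
  refine le_trans (Finset.sum_le_sum fun s _ => ?_) (sum_hilbC_le_mul hJ hQB hQ (2 * t + 1))
  exact hilbC_antitone (N := N) (fun x hx => hJ' hx) s

/-- **The lossy Bézout bound along a chain of cuts of degree `≤ δ`** (`δ ≥ 1`): if
`H_{𝔍 0}(t) ≤ C (t+1)^e` and for `j < r` the cut `Q (j+1) ∈ Fil δ` is a non-zero-divisor modulo
`𝔍 j ≠ (1)` with `𝔍 j + (Q (j+1)) ≤ 𝔍 (j+1)`, then for `j ≤ r`, `j ≤ e`: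
`H_{𝔍 j}(t) ≤ 2^{e j} δ^j C (t+1)^{e-j}`. [cite: NesterenkoPhilippon2001, Ch. 11 Prop. 2.2 (lossy form)] -/
theorem hilbC_chain_le (𝔍 : ℕ → Ideal (MvPolynomial (Fin (N + 1)) ℂ)) (Q : ℕ → MvPolynomial (Fin (N + 1)) ℂ)
    (r e C δ : ℕ) (h0 : ∀ t, hilbC ((𝔍 0).restrictScalars ℂ) t ≤ C * (t + 1) ^ e)
    (hne : ∀ j < r, 𝔍 j ≠ ⊤) (hQB : ∀ j < r, Q (j + 1) ∈ Fil (N := N) δ)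
    (hQ : ∀ j < r, GaGm.IsNZDMod (𝔍 j) (Q (j + 1))) (hstep : ∀ j < r, 𝔍 j ⊔ Ideal.span {Q (j + 1)} ≤ 𝔍 (j + 1)) :
    ∀ j, j ≤ r → j ≤ e → ∀ t,
      hilbC ((𝔍 j).restrictScalars ℂ) t ≤ 2 ^ (e * j) * δ ^ j * C * (t + 1) ^ (e - j) := by
  intro j
  induction j with
  | zero => intro _ _ t; simpa using h0 t
  | succ j ih =>
    intro hjr hje t
    have hj : j < r := by omega
    have hstep' := succ_mul_hilbC_le (hne j hj) (hQB j hj) (hQ j hj) (hstep j hj) t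
    have hih := ih (by omega) (by omega) (2 * t + 1)
    have e1 : (2 * t + 1 + 1) ^ (e - j) = 2 ^ (e - j) * (t + 1) ^ (e - (j + 1)) * (t + 1) := by
      rw [show 2 * t + 1 + 1 = 2 * (t + 1) by ring, mul_pow, show e - j = (e - (j + 1)) + 1 by omega, pow_succ]
      ring
    rw [e1] at hih
    have h3 : (t + 1) * hilbC (N := N) ((𝔍 (j + 1)).restrictScalars ℂ) t ≤
        (t + 1) * (2 ^ (e * (j + 1)) * δ ^ (j + 1) * C * (t + 1) ^ (e - (j + 1))) := by
      refine (hstep'.trans (Nat.mul_le_mul_left _ hih)).trans ?_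
      have h2pow : 2 ^ (e * j) * 2 ^ (e - j) ≤ 2 ^ (e * (j + 1)) := by
        rw [← pow_add]
        exact Nat.pow_le_pow_right (by norm_num) (by rw [Nat.mul_succ]; omega)
      calc δ * (2 ^ (e * j) * δ ^ j * C * (2 ^ (e - j) * (t + 1) ^ (e - (j + 1)) * (t + 1)))
          = (t + 1) * ((2 ^ (e * j) * 2 ^ (e - j)) * (δ ^ j * δ) * C * (t + 1) ^ (e - (j + 1))) := by ring
        _ ≤ (t + 1) * (2 ^ (e * (j + 1)) * (δ ^ j * δ) * C * (t + 1) ^ (e - (j + 1))) :=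
            Nat.mul_le_mul_left _ (Nat.mul_le_mul_right _ (Nat.mul_le_mul_right _ (Nat.mul_le_mul_right _ h2pow)))
        _ = (t + 1) * (2 ^ (e * (j + 1)) * δ ^ (j + 1) * C * (t + 1) ^ (e - (j + 1))) := by rw [pow_succ]
    exact Nat.le_of_mul_le_mul_left h3 (Nat.succ_pos t)

/-! ### The sandwich for primes -/

/-- `H_𝔭(t) = dim` of the image of `Fil t` in `ℂ[X] ⧸ 𝔭`. [folklore] -/
theorem hilbC_eq_finrank_map (𝔭 : Ideal (MvPolynomial (Fin (N + 1)) ℂ)) (t : ℕ) :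
    hilbC (𝔭.restrictScalars ℂ) t = finrank ℂ ↥((Fil (N := N) t).map (Ideal.Quotient.mkₐ ℂ 𝔭).toLinearMap) := by
  set f := (Ideal.Quotient.mkₐ ℂ 𝔭).toLinearMap.domRestrict (Fil (N := N) t) with hf
  have h1 := LinearMap.finrank_range_add_finrank_ker f
  rw [hf, LinearMap.range_domRestrict, LinearMap.ker_domRestrict] at h1
  have hker : LinearMap.ker (Ideal.Quotient.mkₐ ℂ 𝔭).toLinearMap = 𝔭.restrictScalars ℂ := by
    ext x
    simp [Ideal.Quotient.eq_zero_iff_mem]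
  rw [hker] at h1
  have hcomap : finrank ℂ ↥(Submodule.comap (Fil (N := N) t).subtype (𝔭.restrictScalars ℂ)) =
      finrank ℂ ↥(Fil (N := N) t ⊓ 𝔭.restrictScalars ℂ) := by
    have e : Submodule.comap (Fil (N := N) t).subtype (𝔭.restrictScalars ℂ) =
        Submodule.comap (Fil (N := N) t).subtype (Fil t ⊓ 𝔭.restrictScalars ℂ) := by
      rw [Submodule.comap_inf, Submodule.comap_subtype_self, top_inf_eq]
    rw [e]
    exact (Submodule.comapSubtypeEquivOfLe inf_le_left).finrank_eq
  rw [hcomap] at h1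
  have h2 := hilbC_add_finrank_inf (N := N) (𝔭.restrictScalars ℂ) t
  omega

/-- **The sandwich for a prime** `𝔭` of `ℂ[X₀,…,X_N]` with `dim ℂ[X]/𝔭 = d`:
`ρ·binom(t-a+d, d) ≤ H_𝔭(t) ≤ ρ·binom(t+γ+d, d)` for `t ≥ a`, with an integer `ρ ≥ 1` (the degree
of the cone `V(𝔭)`). [cite: NesterenkoPhilippon2001, Ch. 11 §2.2 (85)] -/
theorem exists_sandwich_of_isPrime {𝔭 : Ideal (MvPolynomial (Fin (N + 1)) ℂ)} [h𝔭 : 𝔭.IsPrime] {d : ℕ}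
    (hd : ringKrullDim (MvPolynomial (Fin (N + 1)) ℂ ⧸ 𝔭) = d) :
    ∃ ρ a γ : ℕ, 1 ≤ ρ ∧ ∀ t, a ≤ t →
      ρ * (t - a + d).choose d ≤ hilbC (𝔭.restrictScalars ℂ) t ∧
      hilbC (N := N) (𝔭.restrictScalars ℂ) t ≤ ρ * (t + γ + d).choose d := by
  haveI : IsDomain (MvPolynomial (Fin (N + 1)) ℂ ⧸ 𝔭) := Ideal.Quotient.isDomain _
  set mk := Ideal.Quotient.mkₐ ℂ 𝔭 with hmk
  set W : Submodule ℂ (MvPolynomial (Fin (N + 1)) ℂ ⧸ 𝔭) := (Fil (N := N) 1).map mk.toLinearMap with hW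
  have h1 : (1 : MvPolynomial (Fin (N + 1)) ℂ ⧸ 𝔭) ∈ W := ⟨1, one_mem_Fil 1, map_one mk⟩
  have hgen : Algebra.adjoin ℂ (W : Set (MvPolynomial (Fin (N + 1)) ℂ ⧸ 𝔭)) = ⊤ := by
    rw [hW, Submodule.map_coe, AlgHom.coe_toLinearMap, Algebra.adjoin_image, adjoin_Fil_one, Algebra.map_top,
      AlgHom.range_eq_top]
    exact Ideal.Quotient.mkₐ_surjective ℂ _
  obtain ⟨ρ, a, γ, hρ, h⟩ :=
    Literature.RingTheory.HilbertSamuel.FilteredHilbert.hilbert_sandwich (K := ℂ) W h1 hgen hd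
  refine ⟨ρ, a, γ, hρ, fun t ht => ?_⟩
  rw [hilbC_eq_finrank_map, ← Fil_one_pow, Submodule.map_pow]
  exact h t ht

/-- A crude polynomial upper bound from the sandwich: `H_𝔭(t) ≤ ρ (γ + d + 1)^d (t+1)^d`. [folklore] -/
theorem hilbC_le_mul_pow_of_sandwich {𝔭 : Submodule ℂ (MvPolynomial (Fin (N + 1)) ℂ)} {ρ a γ d : ℕ}
    (h : ∀ t, a ≤ t → hilbC (N := N) 𝔭 t ≤ ρ * (t + γ + d).choose d) (t : ℕ) :
    hilbC (N := N) 𝔭 t ≤ ρ * (a + γ + d + 1) ^ d * (t + 1) ^ d := by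
  have h1 : hilbC (N := N) 𝔭 t ≤ hilbC 𝔭 (t + a) := hilbC_mono _ (by omega)
  refine h1.trans ((h (t + a) (by omega)).trans ?_)
  rw [mul_assoc]
  refine Nat.mul_le_mul_left _ ?_
  calc (t + a + γ + d).choose d ≤ (t + a + γ + d) ^ d := Nat.choose_le_pow _ _
    _ ≤ ((a + γ + d + 1) * (t + 1)) ^ d := Nat.pow_le_pow_left (by nlinarith) _
    _ = (a + γ + d + 1) ^ d * (t + 1) ^ d := mul_pow _ _ _

/-! ### Thick additivity -/

/-- **Thick additivity** (cumulative Hilbert functions): for pairwise incomparable primes `𝔭ᵢ`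
containing `I` with `𝔭ᵢ^{Mᵢ} ≤ loc 𝔭ᵢ I`, there is `δ` with
`∑ᵢ H_{loc 𝔭ᵢ I}(t - δ) ≤ H_{⋂ᵢ loc 𝔭ᵢ I}(t)` for `t ≥ δ`. [cite: NesterenkoPhilippon2001, Ch. 11 §2.2 (ii)] -/
theorem exists_sum_hilbC_loc_le (I : Ideal (MvPolynomial (Fin (N + 1)) ℂ))
    {ι : Type*} (𝔭 : ι → Ideal (MvPolynomial (Fin (N + 1)) ℂ)) (h𝔭 : ∀ i, (𝔭 i).IsPrime)
    (hinc : ∀ i j, 𝔭 i ≤ 𝔭 j → i = j) (hI : ∀ i, I ≤ 𝔭 i)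
    (hrad : ∀ i, ∃ M : ℕ, 𝔭 i ^ M ≤ GaGm.loc (𝔭 i) (h𝔭 i) I) (S : Finset ι) :
    ∃ δ : ℕ, ∀ t, δ ≤ t →
      ∑ i ∈ S, hilbC ((GaGm.loc (𝔭 i) (h𝔭 i) I).restrictScalars ℂ) (t - δ) ≤
        hilbC (N := N) ((S.inf fun i => GaGm.loc (𝔭 i) (h𝔭 i) I).restrictScalars ℂ) t := by
  classical
  induction S using Finset.induction_on with
  | empty => exact ⟨0, fun t _ => by simp⟩
  | insert i₀ S hi₀ ih =>
    obtain ⟨δ, hδ⟩ := ih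
    have hx : ∀ i ∈ S, ∃ b : MvPolynomial (Fin (N + 1)) ℂ, b ∈ GaGm.loc (𝔭 i) (h𝔭 i) I ∧ b ∉ 𝔭 i₀ := by
      intro i hi
      have hne : i ≠ i₀ := fun h => hi₀ (h ▸ hi)
      have hnot : ¬ (𝔭 i ≤ 𝔭 i₀) := fun hle => hne (hinc i i₀ hle)
      obtain ⟨x, hxi, hxi₀⟩ := Set.not_subset.mp hnot
      obtain ⟨M, hM⟩ := hrad i
      exact ⟨x ^ M, hM (Ideal.pow_mem_pow hxi M), fun h => hxi₀ ((h𝔭 i₀).mem_of_pow_mem _ h)⟩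
    choose! b hb using hx
    set a : MvPolynomial (Fin (N + 1)) ℂ := ∏ i ∈ S, b i with ha
    have haN : a ∈ S.inf fun i => GaGm.loc (𝔭 i) (h𝔭 i) I := by
      refine Submodule.mem_finsetInf.mpr fun i hi => ?_
      rw [ha, ← Finset.mul_prod_erase S b hi]
      exact Ideal.mul_mem_right _ _ (hb i hi).1
    have ha𝔭 : a ∉ 𝔭 i₀ := GaGm.prod_notMem_of_isPrime (h𝔭 i₀) S b fun i hi => (hb i hi).2
    set δ' := a.totalDegree with hδ'
    have haB : a ∈ Fil (N := N) δ' := mem_Fil_totalDegree a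
    refine ⟨δ + δ', fun t ht => ?_⟩
    rw [Finset.sum_insert hi₀, Finset.inf_insert]
    have key := hilbC_add_le_hilbC_inf_of_nzd (N := N)
      (N' := (S.inf fun i => GaGm.loc (𝔭 i) (h𝔭 i) I).restrictScalars ℂ) (J := GaGm.loc (𝔭 i₀) (h𝔭 i₀) I)
      (GaGm.loc_ne_top (h𝔭 i₀) (hI i₀)) haB haN (fun x y hy => Ideal.mul_mem_left _ x hy)
      (GaGm.isNZDMod_loc (h𝔭 i₀) I ha𝔭) (t := t) (by omega)
    have hrs : (S.inf fun i => GaGm.loc (𝔭 i) (h𝔭 i) I).restrictScalars ℂ ⊓ (GaGm.loc (𝔭 i₀) (h𝔭 i₀) I).restrictScalars ℂ =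
        (GaGm.loc (𝔭 i₀) (h𝔭 i₀) I ⊓ S.inf fun i => GaGm.loc (𝔭 i) (h𝔭 i) I).restrictScalars ℂ := by
      rw [inf_comm, Submodule.restrictScalars_inf]
    rw [hrs] at key
    have h1 := hδ t (by omega)
    have h2 : ∑ i ∈ S, hilbC (N := N) ((GaGm.loc (𝔭 i) (h𝔭 i) I).restrictScalars ℂ) (t - (δ + δ')) ≤
        ∑ i ∈ S, hilbC (N := N) ((GaGm.loc (𝔭 i) (h𝔭 i) I).restrictScalars ℂ) (t - δ) :=
      Finset.sum_le_sum fun i _ => hilbC_mono _ (by omega)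
    have h3 : hilbC (N := N) ((GaGm.loc (𝔭 i₀) (h𝔭 i₀) I).restrictScalars ℂ) (t - (δ + δ')) ≤
        hilbC ((GaGm.loc (𝔭 i₀) (h𝔭 i₀) I).restrictScalars ℂ) (t - δ') := hilbC_mono _ (by omega)
    omega

end ZeroEst

end Literature.NumberTheory.Transcendental
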